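/-
Copyright: pub-hodgecm formalisation cell (harness21, 2026). New file (not vendored). Gen 3.
-/
import Summits.HodgeConjecture.HodgeCM.Geometry.Statements
import Mathlib.NumberTheory.NumberField.Units.DirichletTheorem

/-!
# Landherr's existence theorem in rank 3 — PROOF of the stub `StubTree.landherr_exists`

`Universe.LandherrExists : ∀ (L : CMField) (ι₁ : L →+* ℂ), Nonempty (HermSpace3 L ι₁)`:
over every CM field `L` and for every complex embedding `ι₁` there is a hermitian 3-space of signature
`(2,1)` at the place of `ι₁` and `(3,0)` at every other place (Landherr 1936; Scharlau, *Quadratic and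
Hermitian Forms*, Ch. 10 — only the trivial EXISTENCE direction is needed and proved here; the
classification direction is the separate stub `StubTree.lemma33b_landherr`).

Proof.  `h = ⟨1, 1, a⟩` with `a ∈ L⁺` negative at the place of `ι₁` and positive elsewhere
(`exists_neg_at_pos_off`).  The element `a`: if `L` has a single infinite place, `a = -1`; otherwise
Dirichlet's unit theorem (Mathlib `NumberField.Units.dirichletUnitTheorem.exists_unit`) gives a unit `u`
with `w u < 1` for every place `w ≠ w₁ := mk ι₁`, the product formula `∑_w mult_w log (w u) = 0`
(`NumberField.Units.sum_mult_mul_log`) forces `w₁ u > 1`, and `a := 1 - u ū ∈ L⁺` has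
`τ a = 1 - ‖τ u‖² ∈ ℝ` of the required signs.  Sylvester at `ι₁` with `T = diag(1, 1, 1/√(-ι₁ a))`;
positive definiteness elsewhere by `Matrix.PosDef.diagonal`.
-/

noncomputable section

open NumberField NumberField.InfinitePlace
open scoped ComplexOrder Matrix

namespace HodgeCM

open Literature.AlgebraicGeometry.ShimuraVarieties

/-- (Ported verbatim from the HodgeCMPerL package; no docstring in the source.) -/
theorem conjRingHomK_apply (L : CMField) (x : L) : conjRingHomK L x = IsCMField.complexConj L x := rfl

/-- (Ported verbatim from the HodgeCMPerL package; no docstring in the source.) -/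
@[simp] theorem conjRingHomK_conjRingHomK (L : CMField) (x : L) :
    conjRingHomK L (conjRingHomK L x) = x := by
  simp [conjRingHomK_apply, IsCMField.complexConj_apply_apply]

/-- `τ (x x̄) = ‖τ x‖²` for every complex embedding `τ` of a CM field. -/
theorem embedding_mul_conjRingHomK (L : CMField) (τ : L →+* ℂ) (x : L) :
    τ (x * conjRingHomK L x) = ((‖τ x‖ ^ 2 : ℝ) : ℂ) := by
  rw [map_mul, embedding_conjRingHomK, Complex.mul_conj, Complex.normSq_eq_norm_sq]

/-- The arithmetic input: an element of `L⁺` (fixed by complex conjugation) which is a negative real number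
at `ι₁` and a positive real number at every complex embedding off the place of `ι₁`. -/
theorem exists_neg_at_pos_off (L : CMField) (ι₁ : L →+* ℂ) :
    ∃ a : L, conjRingHomK L a = a ∧ (∃ r : ℝ, ι₁ a = r ∧ r < 0) ∧
      ∀ τ : L →+* ℂ, InfinitePlace.mk τ ≠ InfinitePlace.mk ι₁ → ∃ s : ℝ, τ a = s ∧ 0 < s := by
  by_cases hone : ∀ τ : L →+* ℂ, InfinitePlace.mk τ = InfinitePlace.mk ι₁
  · exact ⟨-1, by simp, ⟨-1, by simp, by norm_num⟩, fun τ hτ => (hτ (hone τ)).elim⟩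
  push Not at hone
  obtain ⟨τ₀, hτ₀⟩ := hone
  set w₁ : InfinitePlace L := InfinitePlace.mk ι₁ with hw₁
  obtain ⟨u, hu⟩ := NumberField.Units.dirichletUnitTheorem.exists_unit L w₁
  set x : L := ((u : 𝓞 L) : L) with hx
  have hlt : ∀ w : InfinitePlace L, w ≠ w₁ → w x < 1 := fun w hw =>
    (Real.log_neg_iff (Units.pos_at_place u w)).mp (hu w hw)
  have hgt : 1 < w₁ x := by
    classical
    have h := Units.sum_mult_mul_log u
    rw [Fintype.sum_eq_add_sum_subtype_ne _ w₁] at h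
    have hne : Nonempty {w : InfinitePlace L // w ≠ w₁} := ⟨⟨InfinitePlace.mk τ₀, hτ₀⟩⟩
    have hneg : ∑ w : {w : InfinitePlace L // w ≠ w₁},
        ((w : InfinitePlace L).mult : ℝ) * Real.log ((w : InfinitePlace L) x) < 0 := by
      calc ∑ w : {w : InfinitePlace L // w ≠ w₁}, ((w : InfinitePlace L).mult : ℝ) * Real.log ((w : InfinitePlace L) x)
          < ∑ _w : {w : InfinitePlace L // w ≠ w₁}, (0 : ℝ) := by
            apply Finset.sum_lt_sum_of_nonempty Finset.univ_nonempty
            intro w _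
            exact mul_neg_of_pos_of_neg (Nat.cast_pos.mpr mult_pos) (hu w.1 w.2)
        _ = 0 := by simp
    have hpos : 0 < (w₁.mult : ℝ) * Real.log (w₁ x) := by linarith
    have hlog : 0 < Real.log (w₁ x) := by
      rcases mul_pos_iff.mp hpos with ⟨_, h2⟩ | ⟨h1, _⟩
      · exact h2
      · exact absurd h1 (not_lt.mpr (Nat.cast_nonneg _))
    exact (Real.log_pos_iff (Units.pos_at_place u w₁).le).mp hlog
  refine ⟨1 - x * conjRingHomK L x, ?_, ?_, ?_⟩
  · simp [map_sub, map_mul, conjRingHomK_conjRingHomK, mul_comm]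
  · refine ⟨1 - ‖ι₁ x‖ ^ 2, ?_, ?_⟩
    · rw [map_sub, map_one, embedding_mul_conjRingHomK]; push_cast; ring
    · have : w₁ x = ‖ι₁ x‖ := by rw [hw₁]; rfl
      rw [this] at hgt
      nlinarith [norm_nonneg (ι₁ x)]
  · intro τ hτ
    refine ⟨1 - ‖τ x‖ ^ 2, ?_, ?_⟩
    · rw [map_sub, map_one, embedding_mul_conjRingHomK]; push_cast; ring
    · have h1 := hlt (InfinitePlace.mk τ) hτ
      have : (InfinitePlace.mk τ) x = ‖τ x‖ := rfl
      rw [this] at h1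
      nlinarith [norm_nonneg (τ x)]

/-- **Landherr's existence theorem, rank 3, signature `(2,1), (3,0)^{g-1}`** — PROVED:
`h = diag(1, 1, a)` with `a` from `exists_neg_at_pos_off`. This closes the stub `StubTree.landherr_exists`
(Reduction.lean), which is now `:= landherr_exists_proof`. -/
theorem landherr_exists_proof : Universe.LandherrExists := by
  intro L ι₁
  obtain ⟨a, ha, ⟨r, hr, hr0⟩, hpos⟩ := exists_neg_at_pos_off L ι₁
  refine ⟨{ Hm := Matrix.diagonal ![1, 1, a], isHermitian := ?_, signature_ι₁ := ?_, posDef_of_ne := ?_ }⟩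
  · intro i j
    fin_cases i <;> fin_cases j <;> simp [Matrix.diagonal, ha]
  · -- Sylvester at ι₁: `T = diag(1, 1, 1/√(-r))`, `Tᴴ · diag(1,1,r) · T = diag(1,1,-1) = signatureMatrix 2`
    have hmap : (Matrix.diagonal ![(1 : L), 1, a]).map ι₁ = Matrix.diagonal ![(1 : ℂ), 1, (r : ℂ)] := by
      rw [Matrix.diagonal_map (map_zero ι₁)]
      congr 1; funext i; fin_cases i <;> simp [hr]
    set c : ℝ := (Real.sqrt (-r))⁻¹ with hc
    have hsq : Real.sqrt (-r) ^ 2 = -r := Real.sq_sqrt (by linarith)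
    have hsqrt_pos : 0 < Real.sqrt (-r) := Real.sqrt_pos.mpr (by linarith)
    have hc0 : c ≠ 0 := inv_ne_zero hsqrt_pos.ne'
    have hcrc : (c : ℂ) * (r : ℂ) * (c : ℂ) = -1 := by
      have : c * r * c = -1 := by
        rw [hc]; field_simp; nlinarith [hsq]
      exact_mod_cast this
    let T : Matrix (Fin 3) (Fin 3) ℂ := Matrix.diagonal ![(1 : ℂ), 1, (c : ℂ)]
    have hdet : T.det ≠ 0 := by
      simp [T, Matrix.det_diagonal, Fin.prod_univ_three, hc0]
    refine ⟨Matrix.GeneralLinearGroup.mkOfDetNeZero T hdet, ?_⟩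
    rw [Matrix.GeneralLinearGroup.val_mkOfDetNeZero, hmap]
    simp only [T, Matrix.diagonal_conjTranspose, Matrix.diagonal_mul_diagonal]
    unfold signatureMatrix
    congr 1; funext i
    fin_cases i <;> simp [Fin.last, hcrc]
  · intro τ hτ
    obtain ⟨s, hs, hs0⟩ := hpos τ hτ
    have hmap : (Matrix.diagonal ![(1 : L), 1, a]).map τ = Matrix.diagonal ![(1 : ℂ), 1, (s : ℂ)] := by
      rw [Matrix.diagonal_map (map_zero τ)]
      congr 1; funext i; fin_cases i <;> simp [hs]
    rw [hmap]
    apply Matrix.PosDef.diagonal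
    intro i
    fin_cases i <;> simp [Complex.zero_lt_real, hs0]

end HodgeCM

end
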